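import Mathlib
import Literature.NumberTheory.GaloisRepresentations.SerreCartanSubgroupsGL2FpProofs
import Summits.HodgeConjecture.FermatCycles.HodgeFermatTheoremLRowsB
import Summits.HodgeConjecture.FermatCycles.HodgeFermatCoincFullB
import Summits.HodgeConjecture.FermatCycles.HodgeFermatPropL7aB

/-!
# DESCENT LEMMA (`tables/DPRIME-THEOREM.md` §3) — the solitary type `(n/3)(w,w,w)` at the squarefree levels (`HodgeFermat/Descent.lean`)

Tree copy (whole module) of the module `HodgeFermat/Descent.lean` of the sibling cell's standalone package
`run/shared/lean/pub/pub-hodgefermat/lean/HodgeFermat/` (247 lines, sha256 `aebb29b66cac41c0…`), source lines 36–247 (all: `DescentLemma`, `sameType_descend`, `three_or_fifteen`, `z3_vs_any`, `entry_factor`, `descent`, `descent′`, `no_partner_of_constant`).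
Filed by cell `pub-hfermat`, seat prover-1 gen-3, on the COORDINATOR KEEPER RULING of 2026-08-25 (gem sweep H1: take the
off-gate kernel theorem `thmFstar` through the gate) — here THEOREM F* of `tables/DPRIME-THEOREM.md` §9 IN FULL, i.e.
PROPOSITION D′(3N) and the descent (`HodgeFermat/PropDPrimeNFinal.lean`, GATE HF-G34), the last off-gate form of THEOREM F*
(its first two forms, `DecodingFinal.thmFstar` = F* at the prime levels and `ThmFstarNFinal.thmFstar` = F*(3N), landed on
2026-08-25 as `HodgeFermatThmFstar.lean` / `HodgeFermatThmFstarN.lean`, seats prover-1 gen-0 / gen-2); this file is one link of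
the import closure of `PropDPrimeNFinal.propDprime` (the sibling's KR-free chain: THEOREM L, COROLLARY M, THEOREM D6,
THEOREM U⁺, THEOREM KR6, THEOREM Z3U) on top of those landed chains.  The source module is the sibling's hub-checked module of
record (pub-hodgefermat cell record `check/Descent_standalone.lean` sha256 `6b627168e39c8e8b…` (GATE HF-G29 series)); its declarations are copied VERBATIM.
Deviations from the source module, exhaustively: the `import` lines (tree modules `Summits.HodgeConjecture.FermatCycles.
HodgeFermat*` instead of `HodgeFermat.*`); this module docstring; DEDUP (pre-empting the gate's `dedup.landed`): the source's `lemma sameType_symm'` (l.57–58) restates the landed `HodgeFermat.KRFree.Decoding.st_symm` (`HodgeFermatDecodingC.lean`) VERBATIM and the source's `lemma prime_ge_seven` (l.81–85) restates the landed `Literature.NumberTheory.GaloisRepresentations.Serre1972.seven_le_of_prime` (`Literature/NumberTheory/GaloisRepresentations/SerreCartanSubgroupsGL2FpProofs.lean`) VERBATIM up to names; both are DELETED and re-bound by the added lines `open HodgeFermat.KRFree.Decoding renaming st_symm → sameType_symm'` / `open Literature.NumberTheory.GaloisRepresentations.Serre1972 renaming seven_le_of_prime → prime_ge_seven` (extra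 imports) so that every use site (source l.136, 206, 215, 238) stays byte-identical; likewise the source's `sameType_descend` (l.60–79) and `z3_vs_any` (l.118–161) are VERBATIM the lemmas of the same names in the sibling's `PropL7a.lean` (namespace `HodgeFermat.KRFree.TheoremL`, tree file `HodgeFermatPropL7aB.lean`, landed first) and are DELETED — this module already has `open … HodgeFermat.KRFree.TheoremL`, so the names resolve to those (extra import), and the added line `export HodgeFermat.KRFree.TheoremL (sameType_descend z3_vs_any)` keeps the qualified names `Descent.sameType_descend` / `Descent.z3_vs_any` (used downstream, e.g. `PropDPrimeN.lean` l.156) available as aliases; downstream `open HodgeFermat.KRFree.Descent (…)` lists are shortened accordingly in those files.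
Every other line — in particular every declaration's statement and proof — is byte-identical to the source.
HONEST FRAMING: explicit algebraic cycles for specific Hodge classes on Fermat/Delsarte varieties; residual open instances
listed; no claim on general Hodge.  (This file is arithmetic of CM types / finite combinatorics / analytic number theory
of the sibling's KR-free programme; it claims nothing about cycles.)

The source module's docstring (Descent.lean l.7–34), verbatim:

## DESCENT LEMMA (`tables/DPRIME-THEOREM.md` §3) — the solitary type `(n/3)(w,w,w)` at the squarefree levels
divisible by 3 (HF-G29b)

THEOREM L's refinement of the row (U, Z1) at `p = 11` and PROPOSITION L7 (a)/(b) at the levels `m = pn` with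
`3 ∣ n` (`tables/DPRIME-THEOREM.md` §3) end in the same place: the reduced triple `T̄` of level `n` has the CM type
of the CONSTANT triple `V = (n/3)(w, w, w)`, `w ∈ {1, 2}`, and one needs `T̄ = V`.  This is the DESCENT LEMMA:

  **DESCENT LEMMA.**  `n` squarefree, odd, `3 ∣ n`; `w ∈ {1, 2}`; `S = (x, y, z)` of level `n` (zero sum) with no
  entry `≡ 0 (mod n)`.  If `S` and `V = (n/3)(w, w, w)` have the same CM type then `S ≡ V (mod n)` entrywise.

Kernel proof (`descent : DescentLemma`, strong induction on `n`; no hypothesis, no computation beyond the two 15-level facts of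
`CoincFull`):
* DESCENT STEP (`sameType_descend`, as in `PropL7a`): a prime `q ≠ 3` of `n` dividing `x, y, z` divides the entries
  `(n/3)w = q·((n/q)/3)w` of `V` too, and `(S/q, V/q)` is the same configuration at the level `n/q` — induct.
* LOCAL SIEVE (`z3_vs_any`, the rows (Z3, U) for `q ≥ 5` and (Z3, Z1) for `q ≥ 7` of THEOREM L, `TheoremLRows`,
  generation 21, up to a permutation of the entries — `CoincFull.sameType_perm`): otherwise, at every prime `q ∣ n`,
  `q ∉ {3, 5}` (so `q ≥ 7`, `prime_ge_seven`), `V` is Z3 and `S` is U or Z1 — impossible.  So every prime of `n` is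
  3 or 5: `n ∈ {3, 15}` (`three_or_fifteen`, squarefreeness).
* THE TWO SMALL LEVELS: at `n = 3`, `S ∼ (w, w, w)` forces `S ≡ (w, w, w)` (`CoincFull.solo_of_check` with the
  4-case certificate `soloCheck 3 w`); at `n = 15`, F15a's solitary classes `(5, 5, 5)`, `(10, 10, 10)`
  (`CoincFull.solo_15₅`, `solo_15₁₀`, generation 27e, kernel `decide`).
The prime 3 itself is never sieved (at 3, `V` is a triple of units and nothing is claimed about `S`), which is why
no input at the prime 3 (THEOREM Z3U, THEOREM KR6) is needed: the lemma is CLOSED in the kernel — axioms of `descent`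
= the three.  Hub record `check/Descent_standalone.lean` (bodies `LemmaN`, `LemmaO`, `TheoremLRows`, `TheoremUEq`,
`CoincEnum`, `CoincFull`, this file; `--axioms HodgeFermat.KRFree.Descent.descent`); no link check is needed.
`GATE.md` § HF-G29b; `tables/DPRIME-THEOREM.md` §3.
-/

set_option autoImplicit false

namespace HodgeFermat.KRFree.Descent

open HodgeFermat.KRFree.LemmaN HodgeFermat.KRFree.LemmaO HodgeFermat.KRFree.TheoremL
open HodgeFermat.KRFree.TheoremUEq (Perm3)
open HodgeFermat.KRFree.CoincFull (sameType_perm solo_of_check soloCheck solo_15₅ solo_15₁₀)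

open HodgeFermat.KRFree.Decoding renaming st_symm → sameType_symm'
open Literature.NumberTheory.GaloisRepresentations.Serre1972 renaming seven_le_of_prime → prime_ge_seven
export HodgeFermat.KRFree.TheoremL (sameType_descend z3_vs_any)

/-! ## Statement -/

/-- **DESCENT LEMMA** (`tables/DPRIME-THEOREM.md` §3): at a squarefree odd level `n` divisible by 3, a zero-sum
triple `(x, y, z)` with no entry `≡ 0 (mod n)` that has the CM type of the constant triple `(n/3)(w, w, w)`,
`w ∈ {1, 2}`, IS that triple mod `n`. -/
def DescentLemma : Prop :=
  ∀ n w x y z : ℕ, Squarefree n → ¬ 2 ∣ n → 3 ∣ n → (w = 1 ∨ w = 2) →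
    n ∣ x + y + z → ¬ n ∣ x → ¬ n ∣ y → ¬ n ∣ z →
    SameType n (x, y, z) (n / 3 * w, n / 3 * w, n / 3 * w) →
    x % n = n / 3 * w ∧ y % n = n / 3 * w ∧ z % n = n / 3 * w

/-! ## Small lemmas -/

/-- a squarefree multiple of 3 all of whose prime factors are 3 or 5 is 3 or 15 -/
lemma three_or_fifteen {n : ℕ} (hsq : Squarefree n) (h3 : 3 ∣ n)
    (h35 : ∀ q, Nat.Prime q → q ∣ n → q = 3 ∨ q = 5) : n = 3 ∨ n = 15 := by
  obtain ⟨k, rfl⟩ := h3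
  have hsq1 : ∀ q, Nat.Prime q → ¬ q * q ∣ 3 * k := fun q hq h =>
    hq.one_lt.ne' (Nat.isUnit_iff.mp (hsq q h))
  have h3k : ¬ 3 ∣ k := fun h => hsq1 3 Nat.prime_three (Nat.mul_dvd_mul_left 3 h)
  by_cases hk1 : k = 1
  · left; subst hk1; rfl
  right
  have hq : Nat.Prime (Nat.minFac k) := Nat.minFac_prime hk1
  have hqk : Nat.minFac k ∣ k := Nat.minFac_dvd k
  rcases h35 _ hq (dvd_mul_of_dvd_right hqk 3) with hq3 | hq5
  · exact absurd (hq3 ▸ hqk) h3k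
  obtain ⟨j, hj⟩ := hqk
  rw [hq5] at hj
  subst hj
  have h5j : ¬ 5 ∣ j := by
    rintro ⟨i, rfl⟩
    exact hsq1 5 (by norm_num) ⟨3 * i, by ring⟩
  by_cases hj1 : j = 1
  · subst hj1; rfl
  exfalso
  have hr : Nat.Prime (Nat.minFac j) := Nat.minFac_prime hj1
  have hrj : Nat.minFac j ∣ j := Nat.minFac_dvd j
  rcases h35 _ hr (dvd_mul_of_dvd_right (dvd_mul_of_dvd_right hrj 5) 3) with hr3 | hr5
  · exact h3k (dvd_mul_of_dvd_right (hr3 ▸ hrj) 5)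
  · exact h5j (hr5 ▸ hrj)

/-! ## The local sieve at a prime `q ≥ 7`: rows (Z3, U) and (Z3, Z1) of THEOREM L up to a permutation -/

/-! ## The DESCENT LEMMA -/

/-- `3 ∣ q·n'` with `q ≠ 3` prime: `3 ∣ n'`, and the entry of `V` factors: `(q n')/3 · w = q · ((n'/3) w)` -/
lemma entry_factor {q n' w : ℕ} (hq : q.Prime) (hq3 : q ≠ 3) (h3 : 3 ∣ q * n') :
    3 ∣ n' ∧ q * n' / 3 * w = q * (n' / 3 * w) := by
  have hco : Nat.Coprime 3 q := (Nat.coprime_primes Nat.prime_three hq).mpr (Ne.symm hq3)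
  have h3n' : 3 ∣ n' := hco.dvd_of_dvd_mul_left h3
  exact ⟨h3n', by rw [Nat.mul_div_assoc q h3n', Nat.mul_assoc]⟩

/-- **DESCENT LEMMA** in the kernel (closed: no hypothesis). -/
theorem descent : DescentLemma := by
  intro n
  induction n using Nat.strong_induction_on with
  | _ n ih =>
  intro w x y z hsq h2 h3 hw hs hx hy hz hH
  have hn : 0 < n := Nat.pos_of_ne_zero (by rintro rfl; exact absurd hsq not_squarefree_zero)
  by_cases hA : ∃ q, Nat.Prime q ∧ q ≠ 3 ∧ q ∣ n ∧ q ∣ x ∧ q ∣ y ∧ q ∣ z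
  · -- DESCENT STEP: divide by the common prime `q ≠ 3`
    obtain ⟨q, hq, hq3, ⟨n', rfl⟩, ⟨x', rfl⟩, ⟨y', rfl⟩, ⟨z', rfl⟩⟩ := hA
    have hq0 : 0 < q := hq.pos
    have hn' : 0 < n' := Nat.pos_of_ne_zero (by rintro rfl; simp at hn)
    obtain ⟨h3n', eV⟩ := entry_factor (w := w) hq hq3 h3
    rw [eV] at hH ⊢
    have hH' : SameType n' (x', y', z') (n' / 3 * w, n' / 3 * w, n' / 3 * w) := sameType_descend hq0 hn' hH
    have hlt : n' < q * n' := by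
      have h2q := Nat.mul_le_mul_right n' hq.two_le
      omega
    have hsq' : Squarefree n' := Squarefree.squarefree_of_dvd (dvd_mul_left n' q) hsq
    have h2' : ¬ 2 ∣ n' := fun h => h2 (dvd_mul_of_dvd_right h q)
    have hs' : n' ∣ x' + y' + z' := by
      have h1 : q * n' ∣ q * (x' + y' + z') := by simpa [mul_add] using hs
      exact Nat.dvd_of_mul_dvd_mul_left hq0 h1
    have hx' : ¬ n' ∣ x' := fun h => hx (Nat.mul_dvd_mul_left q h)
    have hy' : ¬ n' ∣ y' := fun h => hy (Nat.mul_dvd_mul_left q h)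
    have hz' : ¬ n' ∣ z' := fun h => hz (Nat.mul_dvd_mul_left q h)
    obtain ⟨ex, ey, ez⟩ := ih n' hlt w x' y' z' hsq' h2' h3n' hw hs' hx' hy' hz' hH'
    rw [Nat.mul_mod_mul_left, Nat.mul_mod_mul_left, Nat.mul_mod_mul_left, ex, ey, ez]
    exact ⟨rfl, rfl, rfl⟩
  · by_cases hB : ∃ q, Nat.Prime q ∧ q ≠ 3 ∧ q ≠ 5 ∧ q ∣ n
    · -- LOCAL SIEVE at a prime `q ≥ 7` of `n`: `V` is Z3 at `q`, `S` is not
      exfalso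
      obtain ⟨q, hq, hq3, hq5, ⟨N', rfl⟩⟩ := hB
      have hq2 : q ≠ 2 := by rintro rfl; exact h2 (dvd_mul_right 2 N')
      have h7 : 7 ≤ q := prime_ge_seven hq hq2 hq3 hq5
      have hqN : ¬ q ∣ N' := fun h =>
        hq.one_lt.ne' (Nat.isUnit_iff.mp (hsq q (Nat.mul_dvd_mul_left q h)))
      have hN : 0 < N' := Nat.pos_of_ne_zero (by rintro rfl; simp at hn)
      have h2N : ¬ 2 ∣ N' := fun h => h2 (dvd_mul_of_dvd_right h q)
      have hodd : Odd N' := Nat.odd_iff.mpr (Nat.two_dvd_ne_zero.mp h2N)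
      obtain ⟨-, eV⟩ := entry_factor (w := w) hq hq3 h3
      rw [eV] at hH
      have hne : ¬ (q ∣ x ∧ q ∣ y ∧ q ∣ z) := fun h => hA ⟨q, hq, hq3, dvd_mul_right q N', h.1, h.2.1, h.2.2⟩
      exact z3_vs_any q N' _ _ _ x y z hq h7 hqN hN hodd hs hne hx hy hz (sameType_symm' hH)
    · -- every prime of `n` is 3 or 5: `n ∈ {3, 15}`, the two small levels
      have h35 : ∀ q, Nat.Prime q → q ∣ n → q = 3 ∨ q = 5 := by
        intro q hq hqn
        by_contra hc
        exact hB ⟨q, hq, fun e => hc (Or.inl e), fun e => hc (Or.inr e), hqn⟩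
      rcases three_or_fifteen hsq h3 h35 with rfl | rfl
      · rcases hw with rfl | rfl
        · norm_num at hH ⊢
          exact solo_of_check (N := 3) (x := 1) (by norm_num) (by decide +kernel) x y z hx hy hz hs hH
        · norm_num at hH ⊢
          exact solo_of_check (N := 3) (x := 2) (by norm_num) (by decide +kernel) x y z hx hy hz hs hH
      · rcases hw with rfl | rfl
        · norm_num at hH ⊢
          exact solo_15₅ x y z hx hy hz hs hH
        · norm_num at hH ⊢
          exact solo_15₁₀ x y z hx hy hz hs hH

/-- the DESCENT LEMMA with the constant triple written first -/
theorem descent' (n w x y z : ℕ) (hsq : Squarefree n) (h2 : ¬ 2 ∣ n) (h3 : 3 ∣ n) (hw : w = 1 ∨ w = 2)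
    (hs : n ∣ x + y + z) (hx : ¬ n ∣ x) (hy : ¬ n ∣ y) (hz : ¬ n ∣ z)
    (hH : SameType n (n / 3 * w, n / 3 * w, n / 3 * w) (x, y, z)) :
    x % n = n / 3 * w ∧ y % n = n / 3 * w ∧ z % n = n / 3 * w :=
  descent n w x y z hsq h2 h3 hw hs hx hy hz (sameType_symm' hH)

/-- the DESCENT LEMMA as a non-coincidence statement: a triple with an entry `≢ (n/3)w` never has the CM type of
`(n/3)(w, w, w)` -/
theorem no_partner_of_constant (n w x y z : ℕ) (hsq : Squarefree n) (h2 : ¬ 2 ∣ n) (h3 : 3 ∣ n)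
    (hw : w = 1 ∨ w = 2) (hs : n ∣ x + y + z) (hx : ¬ n ∣ x) (hy : ¬ n ∣ y) (hz : ¬ n ∣ z)
    (hne : x % n ≠ n / 3 * w) : ¬ SameType n (x, y, z) (n / 3 * w, n / 3 * w, n / 3 * w) :=
  fun hH => hne (descent n w x y z hsq h2 h3 hw hs hx hy hz hH).1

end HodgeFermat.KRFree.Descent
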